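import Mathlib
import Summits.Ventures.PercRepro2.PMK5LocusPendant
import Summits.Ventures.PercRepro2.PMK5LocusPendantB
import Summits.Ventures.PercRepro2.PMK5LocusPendantO
import Summits.Ventures.PercRepro2.PMK5LocusPendantRoot
import Summits.Ventures.PercRepro2.PMK5LocusPendantRootA

/-!
# (HCOV) IS STRICT ON THE OPEN CUBE OF EVERY SIX-VERTEX GRAPH IN WHICH `a₃` IS A LEAF
(blind cell PercRepro2, mine-2 g24; the `m = K₅` corollaries of Theorems 19–22 / 22′: with all eleven weights strictly
between `0` and `1` the crux functional is strictly positive on each of the five pendant families — the leaf at the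
unmarked `u` (`ends6`), at `b` (`ends6b`), at `o` (`ends6o`), at the root `a₂` (`ends6r`), at the root `a₁`
(`ends6ra`); `K₅` itself is degenerate for none of the rules.)  Standard axioms.
-/

namespace Summit.Ventures.PercRepro2

open Hub CovForm

namespace K5

namespace PM

/-- `K₅` is not `A`-degenerate. -/
theorem ruleA_K5' : RuleA 1023 = false := by decide +kernel

/-- `K₅` is not `SS`-degenerate. -/
theorem ruleSS_K5 : RuleSS 1023 = false := by decide +kernel

/-- Every `K₅` edge is in the full mask. -/
lemma testBit_1023 (e : Fin 10) : (1023 : ℕ).testBit e = true := by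
  revert e; decide

section Cube

variable {R : Type*} [Field R] [LinearOrder R] [IsStrictOrderedRing R]

/-- **(HCOV) strict on the open cube of `K₅ + a₃ pendant at u`.** -/
theorem gc6_pos (p : Fin 11 → R) (hp : ∀ e, 0 < p e ∧ p e < 1) : 0 < Gc p Pendant.ends6 0 1 2 5 4 :=
  gc6_pos_of_face 1023 (by norm_num) ruleB_K5 p (fun e _ => hp _)
    (fun e he => absurd (testBit_1023 e) (by simpa using he)) (hp _)

/-- **(HCOV) strict on the open cube of `K₅ + a₃ pendant at b`.** -/
theorem gc6b_pos (p : Fin 11 → R) (hp : ∀ e, 0 < p e ∧ p e < 1) : 0 < Gc p PendantB.ends6b 0 1 2 5 4 :=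
  gc6b_pos_of_face 1023 (by norm_num) ruleA_K5' p (fun e _ => hp _)
    (fun e he => absurd (testBit_1023 e) (by simpa using he)) ⟨(hp _).1.le, (hp _).2⟩

/-- **(HCOV) strict on the open cube of `K₅ + a₃ pendant at o`.** -/
theorem gc6o_pos (p : Fin 11 → R) (hp : ∀ e, 0 < p e ∧ p e < 1) : 0 < Gc p PendO.ends6o 0 1 2 5 4 :=
  gc6o_pos_of_face 1023 (by norm_num) ruleA_K5' p (fun e _ => hp _)
    (fun e he => absurd (testBit_1023 e) (by simpa using he)) (hp _).2

/-- **(HCOV) strict on the open cube of `K₅ + a₃ pendant at the root `a₂`.** -/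
theorem gc6r_pos (p : Fin 11 → R) (hp : ∀ e, 0 < p e ∧ p e < 1) : 0 < Gc p PendR.ends6r 0 1 2 5 4 :=
  gc6r_pos_of_face 1023 (by norm_num) ruleSS_K5 p (fun e _ => hp _)
    (fun e he => absurd (testBit_1023 e) (by simpa using he)) (hp _)

/-- `K₅` is not `SS′`-degenerate. -/
theorem ruleSSb_K5 : RuleSSb 1023 = false := by decide +kernel

/-- **(HCOV) strict on the open cube of `K₅ + a₃ pendant at the root `a₁`.** -/
theorem gc6ra_pos (p : Fin 11 → R) (hp : ∀ e, 0 < p e ∧ p e < 1) : 0 < Gc p PendRA.ends6ra 0 1 2 5 4 :=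
  gc6ra_pos_of_face 1023 (by norm_num) ruleSSb_K5 p (fun e _ => hp _)
    (fun e he => absurd (testBit_1023 e) (by simpa using he)) (hp _)

end Cube

end PM

end K5

end Summit.Ventures.PercRepro2
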